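import Summits.QuantumFields.BalabanUV.T4Continuum.Support.NE7BalabanSoftOperator
import HarnessLib

/-!
# NE7GaugeFixOnPureGauges — THE GAUGE-FIXING TERM OF BAŁABAN's SOFT OPERATOR ON OUR CARRIER, IDENTIFIED: the adjoint of the covariant gradient IS the covariant divergence
# (`D_W* b = resS(covDiv W (extF b))`, periodic summation by parts), the Landau projection `R(W)` FIXES every `resS(Δ_W μ)`, `μ ∈ N(Q′(W))`, hence on a PURE GAUGE `g = D_W μ`,
# `μ ∈ N(Q′(W))`: `R(W)(D_W* g) = D_W* g = resS(Δ_W μ)` and the gauge-fixing square is `⟪R D* g, R D* g⟫ = Σ_{periodBox} nhsNormSq (Δ_W μ)` EXACTLY — the (g)-diagonal term of the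
# positivity letter (P_a) (memo §10) (file 138 of the curved (APE), F209)

Cell `pub-balaban`, rung (B)+1 sub-cell t4, lineage `b2b-balaban-t4-ne7-p1` (CRUX PROVER NE7 #1 = OWNER of row NE7), generation 85; memo
`t4/b2b-balaban-t4-ne7-p1-g85/LAGRANGE-CARRIER.md` §10.  Over F192 `NE7BalabanSoftOperator` (`gradOpK`, `landauTestsK`, `landauProjK`, `inner_gradOpK_right`), row NE3's
`NE3LandauOrbit.sum_hsR_gaugeDir` (periodic summation by parts `⟨Y, D_Wλ⟩ = ⟨covDiv_W Y, λ⟩`), `covDiv_add_period`, `NE3CurvedCornerGaugeSpace.covDiv_mem_skewAdjoint`,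
`LandauProjectionB8.covDiv_gaugeDir_eq_covLapSite`, Mathlib's `Submodule.starProjection_eq_self_iff` BY NAME.
WHY.  In print `Δ_a(U) = Δ(U) + D R(U) D* + aQ*Q` and on a pure gauge `D_Uλ` with `λ ∈ N(Q′)` the middle term contributes `‖Δ_Uλ‖²` — the source of positivity along the gauge orbit
([B8] §1, [B9] Thm 3.11).  On our carrier this needs two identifications that F192 left implicit: `D_W*` (Mathlib's finite-dimensional adjoint) = the tree's `covDiv`, and `R(W) = id`
on its defining span.  THIS file proves both and the resulting exact formula.
WHAT ([folklore]; 0 def, 0 sorry).  §1 **`adjoint_gradOpK_apply`** (`D_W* b = ⟨resS (covDiv W (extF b)), _⟩`); §2 `landauProjK_eq_self_of_mem`, `landauProjK_resS_covLapSite` (`R` fixes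
`resS(Δ_Wμ)`, `μ ∈ avgKernelGauges`); §3 **`adjoint_gradOpK_gaugeDir`** (`D_W*(D_Wμ) = resS(Δ_Wμ)`), **`landauProj_adjoint_grad_gaugeDir`** (`R(D_W*(D_Wμ)) = resS(Δ_Wμ)`),
**`inner_gaugeFix_pureGauge`** (`⟪R D*(D_Wμ), R D*(D_Wμ)⟫ = Σ_{periodBox} nhsNormSq (Δ_W μ)`).
HONEST FRAMING (page 1): identifications and one exact formula; NO estimate; (P_a) NOT proved; (KL-B) at curved `W` NOT proved; (APE) on curved data NOT proved; NOT ONE-STEP, NOT NE7;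
spine 0∕9; finite T⁴ rung (B)+1 — NOT infinite volume, NOT mass gap, NOT `BetaPertH`, NOT Clay.  Continuum YM on T⁴ ⇐ BetaPertH ∧ nine spine estimates (0/9 proved); BetaPertH ⇐
(D1) ∧ (D4) ∧ CAP+tail; G-an2-4 gates asym, D1 and NE2/3/4.
-/

set_option autoImplicit false

open scoped BigOperators InnerProductSpace Matrix Matrix.Norms.L2Operator
open Finset

namespace Summit.QuantumFields.BalabanUV.T4Continuum.NE7GaugeFixOnPureGauges

open Literature.MathematicalPhysics.QuantumFieldTheory.Balaban1983to89
open B7Prop1Explicit B7Prop2Explicit UnitaryModel MatrixNorms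
open T4AveragingDeficitWall (IsUnitaryCfg IsSkewDir)
open T4AveragingDeficitWallBoundary (periodBox IsPeriodicCfg)
open AveragingDeficitPeriodicCounting (IsPeriodicDir)
open BlockAveragePushDirGauge (gaugeDir isPeriodicDir_gaugeDir)
open NE3CovariantWeitzenbock (covDiv)
open NE3CovariantCalculus (hsR hsR_self)
open NE3HilbertSchmidtTorus
open NE3LandauOrbit (gaugeDir_skew sum_hsR_gaugeDir covDiv_add_period)
open NE3CurvedCornerGaugeSpace (covDiv_mem_skewAdjoint)
open NE3.PairLandauB8 (avgKernelGauges covLapSite mem_avgKernelGauges_iff)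
open NE3.LandauProjectionB8 (covDiv_gaugeDir_eq_covLapSite covLapSite_add_period)
open NE7BalabanSoftOperator

noncomputable section

variable {d : ℕ} {n : Type*} [Fintype n] [DecidableEq n]

section Carrier

variable {W : Site d → Fin d → (Matrix n n ℂ)ˣ} (hWu : IsUnitaryCfg W)

/-! ## §1 The adjoint of the covariant gradient is the covariant divergence -/

include hWu in
/-- The covariant divergence of the extension of a skew torus 1-form is a skew `P`-periodic site field. [folklore] -/
theorem resS_covDiv_mem {P : ℕ} [NeZero P] (hWP : IsPeriodicCfg W (P : ℤ)) (b : skewForms d n P) :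
    resS P (covDiv W (extF P (b : Form d n P))) ∈ skewSecs d n P :=
  resS_mem_skewSecs (covDiv_mem_skewAdjoint hWu b.2) (covDiv_add_period hWP (isPeriodicDir_extF P _))

/-- **`D_W* = covDiv_W` ON THE CHART**: the finite-dimensional adjoint of `gradOpK` at `b` is the restriction of `covDiv W (extF b)` (row NE3's periodic summation by parts
`⟨Y, D_Wλ⟩ = ⟨covDiv_W Y, λ⟩`). [folklore] -/
theorem adjoint_gradOpK_apply {P : ℕ} [NeZero P] (hWP : IsPeriodicCfg W (P : ℤ)) (hP : 1 ≤ P) (b : skewForms d n P) :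
    (LinearMap.adjoint (𝕜 := ℝ) (E := skewSecs d n P) (F := skewForms d n P) (gradOpK hWu P) : skewForms d n P →ₗ[ℝ] skewSecs d n P) b
      = ⟨resS P (covDiv W (extF P (b : Form d n P))), resS_covDiv_mem hWu hWP b⟩ := by
  refine ext_inner_right ℝ fun a => ?_
  have hR : ⟪(⟨resS P (covDiv W (extF P (b : Form d n P))), resS_covDiv_mem hWu hWP b⟩ : skewSecs d n P), a⟫_ℝ
      = ⟪resS (d := d) P (covDiv W (extF P (b : Form d n P))), (a : Sec d n P)⟫_ℝ := rfl
  rw [hR, LinearMap.adjoint_inner_left, inner_gradOpK_right, inner_eq_sum_extS,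
    sum_hsR_gaugeDir hP hWu (isPeriodicDir_extF P _) (extS_add_period P (a : Sec d n P)),
    extS_resS P (covDiv_add_period hWP (isPeriodicDir_extF P _))]

/-! ## §2 The Landau projection fixes its defining span -/

/-- `R(W)` is the identity on `landauTestsK`. [folklore] -/
theorem landauProjK_eq_self_of_mem {L N k : ℕ} [NeZero (N * L ^ k)] (W : Site d → Fin d → (Matrix n n ℂ)ˣ) {a : skewSecs d n (N * L ^ k)}
    (ha : a ∈ landauTestsK (d := d) (n := n) L N k W) : landauProjK L N k W a = a := by
  haveI : CompleteSpace (landauTestsK (d := d) (n := n) L N k W) := FiniteDimensional.complete ℝ _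
  exact (Submodule.starProjection_eq_self_iff (K := landauTestsK (d := d) (n := n) L N k W)).mpr ha

/-- For `μ ∈ N(Q′(W))`, `resS(Δ_W μ)` (a skew torus section at a unitary periodic `W`) is FIXED by `R(W)`. [folklore] -/
theorem landauProjK_resS_covLapSite {L N k : ℕ} [NeZero (N * L ^ k)]
    {μ : Site d → Matrix n n ℂ} (hμ : μ ∈ avgKernelGauges (d := d) (n := n) L N k W)
    (hmem : resS (N * L ^ k) (covLapSite W μ) ∈ skewSecs d n (N * L ^ k)) :
    landauProjK L N k W ⟨resS (N * L ^ k) (covLapSite W μ), hmem⟩ = ⟨resS (N * L ^ k) (covLapSite W μ), hmem⟩ :=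
  landauProjK_eq_self_of_mem W (Submodule.subset_span ⟨μ, hμ, rfl⟩)

/-! ## §3 On a pure gauge `D_W μ`, `μ ∈ N(Q′(W))` -/

variable {L N k : ℕ}

/-- The restriction of a member of `N(Q′(W))` is a skew torus section. [folklore] -/
theorem resS_mem_of_avgKernel [NeZero (N * L ^ k)] {μ : Site d → Matrix n n ℂ} (hμ : μ ∈ avgKernelGauges (d := d) (n := n) L N k W) :
    resS (N * L ^ k) μ ∈ skewSecs d n (N * L ^ k) :=
  resS_mem_skewSecs (mem_avgKernelGauges_iff.mp hμ).1 (mem_avgKernelGauges_iff.mp hμ).2.1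

/-- `(D_W μ on the chart) = resF (gaugeDir W μ)`. [folklore] -/
theorem coe_gradOpK_resS [NeZero (N * L ^ k)] {μ : Site d → Matrix n n ℂ} (hμ : μ ∈ avgKernelGauges (d := d) (n := n) L N k W) :
    ((gradOpK hWu (N * L ^ k) ⟨resS (N * L ^ k) μ, resS_mem_of_avgKernel hμ⟩ : skewForms d n (N * L ^ k)) : Form d n (N * L ^ k))
      = resF (N * L ^ k) (gaugeDir W μ) := by
  rw [coe_gradOpK, Submodule.coe_mk, DW_resS W _ (mem_avgKernelGauges_iff.mp hμ).2.1]

/-- **`D_W*(D_W μ) = resS(Δ_W μ)`** for `μ ∈ N(Q′(W))` (unitary `(N·L^k)`-periodic `W`). [folklore] -/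
theorem adjoint_gradOpK_gaugeDir [NeZero (N * L ^ k)] (hP : 1 ≤ N * L ^ k) (hWP' : IsPeriodicCfg W ((N * L ^ k : ℕ) : ℤ))
    {μ : Site d → Matrix n n ℂ} (hμ : μ ∈ avgKernelGauges (d := d) (n := n) L N k W) :
    ((LinearMap.adjoint (𝕜 := ℝ) (E := skewSecs d n (N * L ^ k)) (F := skewForms d n (N * L ^ k)) (gradOpK hWu (N * L ^ k))
        : skewForms d n (N * L ^ k) →ₗ[ℝ] skewSecs d n (N * L ^ k))
        (gradOpK hWu (N * L ^ k) ⟨resS (N * L ^ k) μ, resS_mem_of_avgKernel hμ⟩) : Sec d n (N * L ^ k))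
      = resS (N * L ^ k) (covLapSite W μ) := by
  obtain ⟨-, hμP, -⟩ := mem_avgKernelGauges_iff.mp hμ
  rw [adjoint_gradOpK_apply hWu hWP' hP, Submodule.coe_mk, coe_gradOpK_resS hWu hμ, extF_resF _ (isPeriodicDir_gaugeDir hWP' hμP),
    covDiv_gaugeDir_eq_covLapSite]

/-- **`R(W)(D_W*(D_W μ)) = resS(Δ_W μ)`** for `μ ∈ N(Q′(W))`: the Landau projection does nothing to the divergence of a pure gauge from `N(Q′)`. [folklore] -/
theorem landauProj_adjoint_grad_gaugeDir [NeZero (N * L ^ k)] (hP : 1 ≤ N * L ^ k) (hWP' : IsPeriodicCfg W ((N * L ^ k : ℕ) : ℤ))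
    {μ : Site d → Matrix n n ℂ} (hμ : μ ∈ avgKernelGauges (d := d) (n := n) L N k W) :
    ((landauProjK L N k W
        ((LinearMap.adjoint (𝕜 := ℝ) (E := skewSecs d n (N * L ^ k)) (F := skewForms d n (N * L ^ k)) (gradOpK hWu (N * L ^ k))
            : skewForms d n (N * L ^ k) →ₗ[ℝ] skewSecs d n (N * L ^ k))
          (gradOpK hWu (N * L ^ k) ⟨resS (N * L ^ k) μ, resS_mem_of_avgKernel hμ⟩)) : skewSecs d n (N * L ^ k)) : Sec d n (N * L ^ k))
      = resS (N * L ^ k) (covLapSite W μ) := by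
  have hmem : resS (N * L ^ k) (covLapSite W μ) ∈ skewSecs d n (N * L ^ k) := by
    rw [← adjoint_gradOpK_gaugeDir hWu hP hWP' hμ]; exact Subtype.coe_prop _
  have heq : (LinearMap.adjoint (𝕜 := ℝ) (E := skewSecs d n (N * L ^ k)) (F := skewForms d n (N * L ^ k)) (gradOpK hWu (N * L ^ k))
            : skewForms d n (N * L ^ k) →ₗ[ℝ] skewSecs d n (N * L ^ k))
          (gradOpK hWu (N * L ^ k) ⟨resS (N * L ^ k) μ, resS_mem_of_avgKernel hμ⟩) = ⟨resS (N * L ^ k) (covLapSite W μ), hmem⟩ :=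
    Subtype.ext (adjoint_gradOpK_gaugeDir hWu hP hWP' hμ)
  rw [heq, landauProjK_resS_covLapSite hμ hmem]

/-- **THE GAUGE-FIXING SQUARE ON A PURE GAUGE**: `⟪R D*(D_Wμ), R D*(D_Wμ)⟫ = Σ_{x ∈ periodBox} nhsNormSq (Δ_W μ x)` for `μ ∈ N(Q′(W))` — the (g)-diagonal term of (P_a). [folklore] -/
theorem inner_gaugeFix_pureGauge [NeZero (N * L ^ k)] (hP : 1 ≤ N * L ^ k) (hWP' : IsPeriodicCfg W ((N * L ^ k : ℕ) : ℤ))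
    {μ : Site d → Matrix n n ℂ} (hμ : μ ∈ avgKernelGauges (d := d) (n := n) L N k W) :
    ⟪landauProjK L N k W
        ((LinearMap.adjoint (𝕜 := ℝ) (E := skewSecs d n (N * L ^ k)) (F := skewForms d n (N * L ^ k)) (gradOpK hWu (N * L ^ k))
            : skewForms d n (N * L ^ k) →ₗ[ℝ] skewSecs d n (N * L ^ k))
          (gradOpK hWu (N * L ^ k) ⟨resS (N * L ^ k) μ, resS_mem_of_avgKernel hμ⟩)),
      landauProjK L N k W
        ((LinearMap.adjoint (𝕜 := ℝ) (E := skewSecs d n (N * L ^ k)) (F := skewForms d n (N * L ^ k)) (gradOpK hWu (N * L ^ k))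
            : skewForms d n (N * L ^ k) →ₗ[ℝ] skewSecs d n (N * L ^ k))
          (gradOpK hWu (N * L ^ k) ⟨resS (N * L ^ k) μ, resS_mem_of_avgKernel hμ⟩))⟫_ℝ
      = ∑ x ∈ periodBox (d := d) (N * L ^ k), nhsNormSq (covLapSite W μ x) := by
  rw [Submodule.coe_inner, landauProj_adjoint_grad_gaugeDir hWu hP hWP' hμ, inner_resS]
  exact Finset.sum_congr rfl fun x _ => hsR_self _

end Carrier

end

end Summit.QuantumFields.BalabanUV.T4Continuum.NE7GaugeFixOnPureGauges
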